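import Summits.ResolutionOfSingularities.ResolutionOfSingularities.Theorems.EquisingularLiftEquisingularLiftNatSaturatedLift
import Literature.AlgebraicGeometry.Motives.VarietiesProjectiveSpaceProofs
import HarnessLib

/-!
# [OURS · L1 W4.5(b) · EL♮(3) · D5 HOPEN, (IN-1) JOINT BIRTH, brick (B4)] THE KEY MODEL'S SPECIAL-FIBRE TRACE AND ITS POSITION OFF `Y`
# — ★ `KeyForm.keyModel_trace`: `(F)~ · 𝒪_{ℙⁿ_k} = 𝓘_{V₊(G)}` under (A2) chartwise radicality, and `supp (F)~ ∌` the generic point of `Y`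

res-type-027 g21 (desk RULING R59 2026-08-28T22:28Z + (a) 22:32Z: «(B4) whole = res-type-027, (B4a) downstairs reduced trace included»; statement
VERBATIM from res-L1-w45b-stub-4 g12's interface file `L/res-L1-w45b-stub-4/KeyFormSIG.lean` 6e4862d4abec49c6, brick (B4) of the split of (IN-1)
`hBirth` of ✓ `TCPlus.opening_pointPhase` / ✓ `TCPlus.hopen_supplier_of₂`). Crux `EquisingularLiftNatThree` = stmt-ResolutionOfSingularities-20148
(parent stmt-…-20038), route `EquisingularLift`, line `sections`. OURS; NOT a statement of any manuscript ([Hironaka2017] is a candidate under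
adjudication, nothing of it is asserted); AI-written, weaker than expert review. No `sorry`, no definition, no instance; standard axioms.
`--supports stmt-ResolutionOfSingularities-20148 --as helper`.

WHAT. `O` a DVR, `θ : O ↠ k` onto a field, `φ = map θ` on `O[x₀,…,xₙ]` (graded), `g = Proj φ : ℙⁿ_k → ℙⁿ_O` the special fibre; `F ∈ O[x]_e` a form
with reduction `G = θ F`; the key model `𝓜 = (F)~` (Fin-1 CILift currency, see (B3) `…NatKeyFormModel`). Two clauses of `hBirth`:
* (M1) TRACE `𝓜.comap g = 𝓘⟨closure V₊(G)⟩` under (A2) «on every standard chart the dehomogenised `G` generates a RADICAL ideal»,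
  `∀ i, (span {aeval (update X i 1) G}).IsRadical` (hBirth's spelling). Route (B4a, downstairs, any field `k`):
  §1 `aeval (update X i 1) = rename i.succAbove ∘ dehomogenize k i` (Literature `ProjectiveSpace.dehomogenize`) and radicality DESCENDS along the
  retraction `killCompl ∘ rename = id` ⇒ `(dehomogenize k i G)` radical in `k[y₁,…,yₙ]`; §2 along the chart algebra isomorphism
  `(k[x]_{x_i})₀ ≅ k[y]` (Literature `ProjectiveSpace.chartAlgEquiv`, `ofChartRingHom_mk : G/x_i^e ↦ dehomogenize G`) the degree-zero ideal
  `(G)_{(x_i)} = (G / x_i^e)` is radical; §3 hence `(G)~` is a RADICAL ideal sheaf (chartwise, the proof of ✓ `SatLift.radical_projIdealSheaf_eq`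
  with the chartwise hypothesis) and equals `𝓘_{supp} = 𝓘_{V₊(G)}` (Mathlib `vanishingIdeal_support`, ✓ `CILift.support_projIdealSheaf_span`);
  then (B4b, upstairs) base change ✓ `CILift.comap_projIdealSheaf_span`: `(F)~ · 𝒪_{ℙⁿ_k} = (G)~`.
* (M4) OFF `Y`: if `H ⊄ V₊(G)` then no point of `supp (F)~` is the generic point of `Y = range (ι ≫ g)` (else `Y ⊆ supp (F)~`, closed, and pulling
  back along `g`: `range ι ⊆ supp (G)~ = V₊(G)`). No radicality needed.

References: [Hartshorne1977, I Thm. 3.4 (proof), II Prop. 2.5, Prop. 5.9, Cor. 5.16, Ex. 3.12]; tree kit (OURS, imported): …NatSaturatedLift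
(res-type-027 g14), …NatCompleteIntersectionLiftProj/Key (res-D-pv-027 AS res-L1-s36-pv-4); Literature `Motives/VarietiesProjectiveSpaceProofs`
(`dehomogenize`, `chartAlgEquiv`), `Resolution/ProjHomogeneousIdealSheaf`.
-/

set_option linter.dupNamespace false -- mandated namespace `Summit.<Summit>.<Problem>` of this single-conjunct summit
set_option linter.overlappingInstances false -- signatures carry `[IsDomain O] [IsDiscreteValuationRing O]`

noncomputable section

open CategoryTheory AlgebraicGeometry TopologicalSpace IsLocalRing
open MvPolynomial HomogeneousLocalization
open Literature.AlgebraicGeometry.Resolution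
open Literature.AlgebraicGeometry.Motives
open AlgebraicGeometry.Scheme.IdealSheafData

namespace Summit.ResolutionOfSingularities.ResolutionOfSingularities.Cruxes.EquisingularLiftNat.Sections

namespace KeyForm

/-! ## §1 Algebra: hBirth's dehomogenisation `aeval (update X i 1)` vs `dehomogenize`, and descent of radicality along a retraction -/

section Algebra

variable {R : Type*} [CommRing R]

/-- **Radicality of a principal ideal descends along a retraction**: if `ρ ∘ r = id` on `A` (`r : A → B`, `ρ : B → A` ring maps) and
`(r d)` is a radical ideal of `B`, then `(d)` is a radical ideal of `A`. [folklore] -/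
theorem isRadical_span_singleton_of_retraction {A B : Type*} [CommRing A] [CommRing B] (r : A →+* B) (ρ : B →+* A)
    (hρ : ∀ a, ρ (r a) = a) (d : A) (h : (Ideal.span {r d}).IsRadical) : (Ideal.span {d}).IsRadical := by
  rintro x ⟨m, hm⟩
  obtain ⟨q, hq⟩ := Ideal.mem_span_singleton'.mp hm
  have hx : r x ∈ (Ideal.span {r d}).radical := ⟨m, by
    rw [← map_pow, ← hq, map_mul]
    exact Ideal.mul_mem_left _ _ (Ideal.mem_span_singleton_self _)⟩
  obtain ⟨c, hc⟩ := Ideal.mem_span_singleton'.mp (h hx)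
  refine Ideal.mem_span_singleton'.mpr ⟨ρ c, ?_⟩
  have := congrArg ρ hc
  rwa [map_mul, hρ, hρ] at this

variable {n : ℕ} (i : Fin (n + 1))

/-- **hBirth's dehomogenisation is `rename i.succAbove ∘ dehomogenize`**: `G(x_i := 1)` computed inside `R[x₀,…,xₙ]` is the re-embedding of
Literature's `dehomogenize R i G ∈ R[y₁,…,yₙ]`. [folklore] -/
theorem aeval_update_X_one_eq_rename_dehomogenize (G : MvPolynomial (Fin (n + 1)) R) :
    MvPolynomial.aeval (Function.update MvPolynomial.X i (1 : MvPolynomial (Fin (n + 1)) R)) G =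
      rename (Fin.succAbove i) (ProjectiveSpace.dehomogenize R i G) := by
  have h : (MvPolynomial.aeval (Function.update MvPolynomial.X i (1 : MvPolynomial (Fin (n + 1)) R)) :
        MvPolynomial (Fin (n + 1)) R →ₐ[R] MvPolynomial (Fin (n + 1)) R) =
      (rename (Fin.succAbove i)).comp (ProjectiveSpace.dehomogenize R i) := by
    refine MvPolynomial.algHom_ext fun s => ?_
    rcases Fin.eq_self_or_eq_succAbove i s with rfl | ⟨j, rfl⟩
    · rw [aeval_X, Function.update_self, AlgHom.comp_apply, ProjectiveSpace.dehomogenize_X_self, map_one]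
    · rw [aeval_X, Function.update_of_ne (Fin.succAbove_ne i j), AlgHom.comp_apply, ProjectiveSpace.dehomogenize_X_succAbove, rename_X]
  exact congrArg (fun ψ : MvPolynomial (Fin (n + 1)) R →ₐ[R] MvPolynomial (Fin (n + 1)) R => ψ G) h

/-- **(A2) ⇒ `(dehomogenize R i G)` is radical in `R[y₁,…,yₙ]`** (retraction `killCompl ∘ rename i.succAbove = id`). [folklore] -/
theorem isRadical_span_dehomogenize (G : MvPolynomial (Fin (n + 1)) R)
    (hA2 : (Ideal.span {MvPolynomial.aeval (Function.update MvPolynomial.X i (1 : MvPolynomial (Fin (n + 1)) R)) G}).IsRadical) :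
    (Ideal.span {ProjectiveSpace.dehomogenize R i G}).IsRadical := by
  rw [aeval_update_X_one_eq_rename_dehomogenize i G] at hA2
  exact isRadical_span_singleton_of_retraction (rename (Fin.succAbove i) : MvPolynomial (Fin n) R →ₐ[R] MvPolynomial (Fin (n + 1)) R).toRingHom
    (killCompl (Fin.succAbove_right_injective (p := i)) : MvPolynomial (Fin (n + 1)) R →ₐ[R] MvPolynomial (Fin n) R).toRingHom
    (fun a => killCompl_rename_app _ a) _ hA2

end Algebra

/-! ## §2 The degree-zero ideal `(G)_{(x_i)} = (G / x_i^e)` is radical under (A2) -/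

section Chart

variable {k : Type} [CommRing k] {n : ℕ}

/-- **`(G)_{(x_i)}` is radical under (A2) at `i`**: through the chart isomorphism `(k[x]_{x_i})₀ ≅ k[y₁,…,yₙ]`, `G/x_i^e ↦ dehomogenize G`
(Literature `ProjectiveSpace.chartAlgEquiv`, `ofChartRingHom_mk`), `(G)_{(x_i)} = (G / x_i^e)` is the preimage of the radical ideal
`(dehomogenize G)`. [cite: Hartshorne1977, I Thm. 3.4 (proof), II Prop. 5.11 (proof)] -/
theorem isRadical_awayIdeal_span_of_chartwise (i : Fin (n + 1)) (G : MvPolynomial (Fin (n + 1)) k) (e : ℕ)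
    (hG : G ∈ homogeneousSubmodule (Fin (n + 1)) k e)
    (hA2 : (Ideal.span {MvPolynomial.aeval (Function.update MvPolynomial.X i (1 : MvPolynomial (Fin (n + 1)) k)) G}).IsRadical) :
    letI := MvPolynomial.gradedAlgebra (σ := Fin (n + 1)) (R := k)
    (awayIdeal (homogeneousSubmodule (Fin (n + 1)) k) (CILift.X_mem_one' i) (Ideal.span (Set.range fun _ : Fin 1 => G))).IsRadical := by
  letI := MvPolynomial.gradedAlgebra (σ := Fin (n + 1)) (R := k)
  letI : Algebra k (Away (homogeneousSubmodule (Fin (n + 1)) k) (X i : MvPolynomial (Fin (n + 1)) k)) :=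
    ProjBaseChange.algebraBase _ _
  rw [awayIdeal_span_eq _ (CILift.X_mem_one' i) (fun _ : Fin 1 => G) (fun _ => e) (fun _ => hG), Set.range_const]
  -- the generator `G / x_i^e` goes to `dehomogenize G` under the chart isomorphism
  have hrad := isRadical_span_dehomogenize i G hA2
  have hE : ProjectiveSpace.chartAlgEquiv k i (mk₁ (homogeneousSubmodule (Fin (n + 1)) k) (CILift.X_mem_one' i) e G hG) =
      ProjectiveSpace.dehomogenize k i G := by
    rw [mk₁]
    exact ProjectiveSpace.ofChartRingHom_mk i e G _
  have hmap : (Ideal.span {mk₁ (homogeneousSubmodule (Fin (n + 1)) k) (CILift.X_mem_one' i) e G hG}).map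
      (ProjectiveSpace.chartAlgEquiv k i) = Ideal.span {ProjectiveSpace.dehomogenize k i G} := by
    rw [Ideal.map_span, Set.image_singleton, hE]
  rw [← Ideal.comap_map_of_bijective (ProjectiveSpace.chartAlgEquiv k i) (ProjectiveSpace.chartAlgEquiv k i).bijective
    (I := Ideal.span {mk₁ (homogeneousSubmodule (Fin (n + 1)) k) (CILift.X_mem_one' i) e G hG}), hmap]
  exact hrad.comap _

end Chart

/-! ## §3 (B4a) Downstairs: `(G)~` is radical and equals `𝓘_{V₊(G)}` -/

section Downstairs

variable {k : Type} [Field k] {n : ℕ}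

/-- **A chartwise-radical homogeneous ideal has a radical ideal sheaf**: if `I_{(x_i)}` is radical for every `i`, then `Ĩ.radical = Ĩ` on `ℙⁿ`
(the sections over the charts `D₊(x_i)` are the `I_{(x_i)}` through `Γ(D₊(x_i)) ≅ (k[x]_{x_i})₀`; proof of ✓ `SatLift.radical_projIdealSheaf_eq`).
[cite: Hartshorne1977, II Cor. 5.16] -/
theorem radical_projIdealSheaf_eq_of_chartwise :
    letI := MvPolynomial.gradedAlgebra (σ := Fin (n + 1)) (R := k)
    ∀ (I : HomogeneousIdeal (homogeneousSubmodule (Fin (n + 1)) k)),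
      (∀ i : Fin (n + 1), (awayIdeal (homogeneousSubmodule (Fin (n + 1)) k) (CILift.X_mem_one' i) I.toIdeal).IsRadical) →
      (projIdealSheaf (homogeneousSubmodule (Fin (n + 1)) k) I).radical = projIdealSheaf (homogeneousSubmodule (Fin (n + 1)) k) I := by
  letI := MvPolynomial.gradedAlgebra (σ := Fin (n + 1)) (R := k)
  intro I hI
  refine Scheme.IdealSheafData.ext_of_iSup_eq_top
    (fun i : Fin (n + 1) => (⟨Proj.basicOpen (homogeneousSubmodule (Fin (n + 1)) k) (X i),
      Proj.isAffineOpen_basicOpen (homogeneousSubmodule (Fin (n + 1)) k) (X i) (CILift.X_mem_one' i) one_pos⟩ :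
        (Proj (homogeneousSubmodule (Fin (n + 1)) k)).affineOpens)) (SatLift.iSup_chart_eq_top k n) fun i => ?_
  rw [Scheme.IdealSheafData.radical_ideal, SatLift.ideal_chart]
  have hker : RingHom.ker (Proj.awayToSection (homogeneousSubmodule (Fin (n + 1)) k) (X i)).hom ≤
      awayIdeal (homogeneousSubmodule (Fin (n + 1)) k) (CILift.X_mem_one' i) I.toIdeal := by
    rw [(RingHom.injective_iff_ker_eq_bot _).mp (SatLift.awayToSection_bijective (k := k) (n := n) i).1]; exact bot_le
  have h := Ideal.map_radical_of_surjective (SatLift.awayToSection_bijective (k := k) (n := n) i).2 hker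
  rw [(hI i).radical] at h
  exact h.symm

/-- ★ **(B4a) THE DOWNSTAIRS REDUCED TRACE `(G)~ = 𝓘_{V₊(G)}`** on `ℙⁿ_k` for a form `G ∈ k[x]_e` under (A2) «`(G(x_i := 1))` radical for every
`i`»: the ideal sheaf of the `Fin 1`-family `(G)` is the vanishing ideal sheaf of the (closed) set `{y | G ∈ 𝔭_y}`, written with the `closure`
of `hBirth`. [cite: Hartshorne1977, II Prop. 5.9 and Cor. 5.16] -/
theorem projIdealSheaf_span_eq_vanishingIdeal_of_chartwise (G : MvPolynomial (Fin (n + 1)) k) (e : ℕ)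
    (hG : G ∈ homogeneousSubmodule (Fin (n + 1)) k e)
    (hA2 : ∀ i : Fin (n + 1), (Ideal.span {MvPolynomial.aeval (Function.update MvPolynomial.X i (1 : MvPolynomial (Fin (n + 1)) k)) G}).IsRadical) :
    letI := MvPolynomial.gradedAlgebra (σ := Fin (n + 1)) (R := k)
    projIdealSheaf (homogeneousSubmodule (Fin (n + 1)) k)
        ⟨Ideal.span (Set.range fun _ : Fin 1 => G), isHomogeneous_span_of_forall_mem _ (fun _ : Fin 1 => G) (fun _ => e) (fun _ => hG)⟩ =
      vanishingIdeal (⟨closure {y : Proj (homogeneousSubmodule (Fin (n + 1)) k) | G ∈ y.asHomogeneousIdeal}, isClosed_closure⟩ :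
        Closeds (Proj (homogeneousSubmodule (Fin (n + 1)) k))) := by
  letI := MvPolynomial.gradedAlgebra (σ := Fin (n + 1)) (R := k)
  -- the support is the (closed) set `{y | G ∈ 𝔭_y}`
  have hsupp : ((projIdealSheaf (homogeneousSubmodule (Fin (n + 1)) k)
      ⟨Ideal.span (Set.range fun _ : Fin 1 => G), isHomogeneous_span_of_forall_mem _ (fun _ : Fin 1 => G) (fun _ => e) (fun _ => hG)⟩).support :
        Set (Proj (homogeneousSubmodule (Fin (n + 1)) k))) = {y | G ∈ y.asHomogeneousIdeal} := by
    rw [CILift.support_projIdealSheaf_span (fun _ : Fin 1 => G) (fun _ => e) (fun _ => hG)]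
    exact Set.ext fun y => ⟨fun h => h 0, fun h _ => h⟩
  have hcl : (⟨closure {y : Proj (homogeneousSubmodule (Fin (n + 1)) k) | G ∈ y.asHomogeneousIdeal}, isClosed_closure⟩ :
        Closeds (Proj (homogeneousSubmodule (Fin (n + 1)) k))) =
      (projIdealSheaf (homogeneousSubmodule (Fin (n + 1)) k)
        ⟨Ideal.span (Set.range fun _ : Fin 1 => G), isHomogeneous_span_of_forall_mem _ (fun _ : Fin 1 => G) (fun _ => e) (fun _ => hG)⟩).support := by
    apply Closeds.ext
    have hc : closure {y : Proj (homogeneousSubmodule (Fin (n + 1)) k) | G ∈ y.asHomogeneousIdeal} =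
        {y : Proj (homogeneousSubmodule (Fin (n + 1)) k) | G ∈ y.asHomogeneousIdeal} := by
      rw [← hsupp]
      exact (Closeds.isClosed _).closure_eq
    exact hc.trans hsupp.symm
  -- radical ideal sheaf = vanishing ideal of its support
  have hrad := radical_projIdealSheaf_eq_of_chartwise (k := k) (n := n)
    ⟨Ideal.span (Set.range fun _ : Fin 1 => G), isHomogeneous_span_of_forall_mem _ (fun _ : Fin 1 => G) (fun _ => e) (fun _ => hG)⟩
    (fun i => isRadical_awayIdeal_span_of_chartwise i G e hG (hA2 i))
  rw [hcl, Scheme.IdealSheafData.vanishingIdeal_support, hrad]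

end Downstairs

/-! ## §4 ★ (B4) Upstairs: the trace of `(F)~` along `g = Proj φ`, and `supp (F)~` off the generic point of `Y` -/

section Trace

/-- ★ **(B4) THE KEY MODEL'S TRACE AND POSITION** (res-L1-w45b-stub-4's `KeyFormSIG.lean`, VERBATIM up to the names of the unused binders
`_hθ`, `_hφ`, `_he`, `_hG0` — the statement holds for any `θ`, without `e > 0` or `G ≠ 0`).
For a form `F ∈ O[x]_e` with reduction `G = θ F`, `H ⊄ V₊(G)` (`ι : H → ℙⁿ_k` a closed immersion of an integral scheme) and (A2):
(M1) `(F)~.comap (Proj φ) = 𝓘⟨closure {y | G ∈ 𝔭_y}⟩` and (M4) `𝟙 '' supp (F)~ ⊆ {y | ¬ IsGenericPoint y (range (ι ≫ Proj φ))}`.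
[cite: Hartshorne1977, II Prop. 5.9, Cor. 5.16, Ex. 3.12] [OURS · L1 W4.5b · D5 HOPEN (IN-1) brick (B4)] -/
theorem keyModel_trace (O : Type) [CommRing O] [IsDomain O] [IsDiscreteValuationRing O] {k : Type} [Field k] [IsAlgClosed k] (θ : O →+* k)
    (_hθ : Function.Surjective θ) {n : ℕ} :
    letI := MvPolynomial.gradedAlgebra (σ := Fin (n + 1)) (R := O)
    letI := MvPolynomial.gradedAlgebra (σ := Fin (n + 1)) (R := k)
    ∀ (φ : homogeneousSubmodule (Fin (n + 1)) O →+*ᵍ homogeneousSubmodule (Fin (n + 1)) k)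
    (hφ' : HomogeneousIdeal.irrelevant (homogeneousSubmodule (Fin (n + 1)) k) ≤ (HomogeneousIdeal.irrelevant (homogeneousSubmodule (Fin (n + 1)) O)).map φ)
    (_hφ : ∀ s, φ s = MvPolynomial.map θ s)
    {H : Scheme.{0}} [IsIntegral H] (ι : H ⟶ Proj (homogeneousSubmodule (Fin (n + 1)) k)) [IsClosedImmersion ι]
    (F : MvPolynomial (Fin (n + 1)) O) (e : ℕ) (_he : 0 < e) (hF : F ∈ homogeneousSubmodule (Fin (n + 1)) O e)
    (G : MvPolynomial (Fin (n + 1)) k) (hFG : MvPolynomial.map θ F = G) (_hG0 : G ≠ 0)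
    (hH : ¬ (Set.range ι ⊆ {y : Proj (homogeneousSubmodule (Fin (n + 1)) k) | G ∈ y.asHomogeneousIdeal}))
    (hA2 : ∀ i : Fin (n + 1), (Ideal.span {MvPolynomial.aeval (Function.update MvPolynomial.X i (1 : MvPolynomial (Fin (n + 1)) k)) G}).IsRadical),
    (projIdealSheaf (homogeneousSubmodule (Fin (n + 1)) O)
          ⟨Ideal.span (Set.range fun _ : Fin 1 => F), isHomogeneous_span_of_forall_mem _ (fun _ : Fin 1 => F) (fun _ => e) (fun _ => hF)⟩).comap
        (Proj.map φ hφ') =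
      vanishingIdeal (⟨closure {y : Proj (homogeneousSubmodule (Fin (n + 1)) k) | G ∈ y.asHomogeneousIdeal}, isClosed_closure⟩ :
        Closeds (Proj (homogeneousSubmodule (Fin (n + 1)) k))) ∧
    (𝟙 (Proj (homogeneousSubmodule (Fin (n + 1)) O)) : _ ⟶ _) ''
        ((projIdealSheaf (homogeneousSubmodule (Fin (n + 1)) O)
          ⟨Ideal.span (Set.range fun _ : Fin 1 => F), isHomogeneous_span_of_forall_mem _ (fun _ : Fin 1 => F) (fun _ => e) (fun _ => hF)⟩).support :
          Set (Proj (homogeneousSubmodule (Fin (n + 1)) O))) ⊆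
      {y | ¬ IsGenericPoint y (Set.range (ι ≫ Proj.map φ hφ'))} := by
  letI := MvPolynomial.gradedAlgebra (σ := Fin (n + 1)) (R := O)
  letI := MvPolynomial.gradedAlgebra (σ := Fin (n + 1)) (R := k)
  intro φ hφ' hφ H _ ι _ F e _ hF G hFG _ hH hA2
  -- the reduction `G` is a form of degree `e`, `φ` fixes the variables and sends `F` to `G`
  have hG : G ∈ homogeneousSubmodule (Fin (n + 1)) k e := by
    rw [← hFG]
    exact (mem_homogeneousSubmodule _ _).mpr (((mem_homogeneousSubmodule _ _).mp hF).map θ)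
  have hφX : ∀ i : Fin (n + 1), φ (X i) = X i := fun i => by rw [hφ, map_X]
  have hφF : ∀ _l : Fin 1, φ F = G := fun _ => by rw [hφ, hFG]
  -- BASE CHANGE `(F)~ · 𝒪_{ℙⁿ_k} = (G)~` (res-D-pv-027)
  have hbc := CILift.comap_projIdealSheaf_span φ hφ' hφX (fun _ : Fin 1 => F) (fun _ : Fin 1 => G) (fun _ => e)
    (fun _ => hF) (fun _ => hG) hφF
  refine ⟨?_, ?_⟩
  · -- (M1) the trace
    rw [hbc]
    exact projIdealSheaf_span_eq_vanishingIdeal_of_chartwise G e hG hA2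
  · -- (M4) off the generic point of `Y`
    rintro _ ⟨y, hy, rfl⟩ hgen
    change IsGenericPoint y _ at hgen
    apply hH
    -- `Y ⊆ supp (F)~` since the support is closed and contains the generic point `y`
    have hY : Set.range (ι ≫ Proj.map φ hφ') ⊆
        ((projIdealSheaf (homogeneousSubmodule (Fin (n + 1)) O)
          ⟨Ideal.span (Set.range fun _ : Fin 1 => F), isHomogeneous_span_of_forall_mem _ (fun _ : Fin 1 => F) (fun _ => e) (fun _ => hF)⟩).support :
          Set (Proj (homogeneousSubmodule (Fin (n + 1)) O))) :=
      (hgen.mem_closed_set_iff (Closeds.isClosed _)).mp hy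
    rintro _ ⟨h, rfl⟩
    have hmem : (ι ≫ Proj.map φ hφ') h ∈ ((projIdealSheaf (homogeneousSubmodule (Fin (n + 1)) O)
        ⟨Ideal.span (Set.range fun _ : Fin 1 => F), isHomogeneous_span_of_forall_mem _ (fun _ : Fin 1 => F) (fun _ => e) (fun _ => hF)⟩).support :
          Set (Proj (homogeneousSubmodule (Fin (n + 1)) O))) := hY ⟨h, rfl⟩
    rw [Scheme.Hom.comp_apply] at hmem
    -- pull back along `g`: `ι h ∈ supp ((F)~ · 𝒪_{ℙⁿ_k}) = supp (G)~ = V₊(G)`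
    have hmem' : ι h ∈ (((projIdealSheaf (homogeneousSubmodule (Fin (n + 1)) O)
        ⟨Ideal.span (Set.range fun _ : Fin 1 => F), isHomogeneous_span_of_forall_mem _ (fun _ : Fin 1 => F) (fun _ => e) (fun _ => hF)⟩).comap
          (Proj.map φ hφ')).support : Set (Proj (homogeneousSubmodule (Fin (n + 1)) k))) := by
      rw [Scheme.IdealSheafData.support_comap]
      exact hmem
    rw [hbc, CILift.support_projIdealSheaf_span (fun _ : Fin 1 => G) (fun _ => e) (fun _ => hG)] at hmem'
    exact hmem' 0

end Trace

end KeyForm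

end Summit.ResolutionOfSingularities.ResolutionOfSingularities.Cruxes.EquisingularLiftNat.Sections

end
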